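import Summits.ResolutionOfSingularities.ResolutionOfSingularities.Theorems.SharpStrataSepExcModelsDvrPairValuation
import HarnessLib

/-!
# Prime divisors are Abhyankar places; the trivial place

Line `birth` of crux `SharpStrata.SepExcModels` (stmt-ResolutionOfSingularities-16828,
`Cruxes/SepExcModels/Lines/birth.lean`), lead c1, third helper file for the tool stub (T6,
ring form) `stub_sepAbhyankarPlace_of_model` (the converse of the valuative criterion).

* `isAbhyankarPlace_of_valuation_lt_one` — the ONE-VALUE analogue of
  `DvrPairValuation.isAbhyankarPlace_of_valuation_zpow`: a valuation ring `O ⊇ k` of `K` with an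
  element `x₀` of value `< 1` and `τ` elements whose residues are algebraically independent over
  `k`, where `tr.deg_k K ≤ τ + 1`, is an Abhyankar place of `K | k` (Knaf–Kuhlmann 2005,
  Thm. 2.1: `(x₀, y)` is algebraically independent, hence a transcendence basis). This is the
  case of a PRIME DIVISOR (`E = 1`, `F = τ = tr.deg - 1`).
* `isAbhyankarPlace_top` — the trivial valuation ring `K` itself is an Abhyankar place of a
  `K | k` of finite transcendence degree (`ρ = 0`, `y` a transcendence basis).
* `formallySmooth_quotient_of_bijective` — for a bijective ring map `φ : R → O` of local rings
  the induced map of residue fields makes `κ(O)` formally smooth over `κ(R)` (it is bijective).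

## Sources

* H. Knaf, F.-V. Kuhlmann, *Abhyankar places admit local uniformization in any characteristic*,
  Ann. Sci. ÉNS 38 (2005) 833–846, Thm. 2.1 and §1. [KnafKuhlmann2005]
* O. Zariski, P. Samuel, *Commutative Algebra* II (1960), Ch. VI §14 (prime divisors).
  [ZariskiSamuel1960]
-/

noncomputable section

-- single-problem summit: the doubled namespace component `ResolutionOfSingularities` is forced
set_option linter.dupNamespace false

open Literature.AlgebraicGeometry.Resolution IsLocalRing
open Summit.ResolutionOfSingularities.ResolutionOfSingularities.Theorems.SepExcModels.DvrPairValuationComposite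

namespace Summit.ResolutionOfSingularities.ResolutionOfSingularities.Theorems.SepExcModels.ModelValuationAbhyankar

variable {k K : Type} [Field k] [Field K] [Algebra k K]

/-- The residue map of `k ⊆ O` onto the residue field `k̃ = resField O k` of the image of `k`
is surjective (every residue of an element of `k` is such a residue). [folklore] -/
theorem exists_ringHom_resField_surjective (O : ValuationSubring K)
    (hkO : ∀ c : k, algebraMap k K c ∈ O) :
    ∃ fk : k →+* resField O (algebraMap k K).fieldRange, Function.Surjective fk ∧
      ∀ c : k, ((fk c : resField O (algebraMap k K).fieldRange) : ResidueField O) =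
        residue O ⟨algebraMap k K c, hkO c⟩ := by
  have hcK : ∀ c : k, (((algebraMap k K).codRestrict O hkO c : O) : K) ∈
      (algebraMap k K).fieldRange := fun c => RingHom.mem_fieldRange.mpr ⟨c, rfl⟩
  let fk : k →+* resField O (algebraMap k K).fieldRange :=
    ((residue O).comp ((algebraMap k K).codRestrict O hkO)).codRestrict
      (resField O (algebraMap k K).fieldRange) fun c => residue_mem_resField O _ (hcK c)
  refine ⟨fk, ?_, fun c => rfl⟩
  rintro ⟨z, hz⟩
  obtain ⟨a, haK, rfl⟩ := (mem_resField_iff O _ z).mp hz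
  obtain ⟨c, hc⟩ := RingHom.mem_fieldRange.mp haK
  refine ⟨c, Subtype.ext ?_⟩
  show residue O ((algebraMap k K).codRestrict O hkO c) = residue O a
  congr 1
  exact Subtype.ext hc

/-- Elements of `k(S) ⊆ K` lie in `k̄(S)` for `k̄` the image of `k` in `K`. [folklore] -/
theorem mem_adjoin_fieldRange_of_mem_adjoin {S : Set K} {w : K}
    (hw : w ∈ IntermediateField.adjoin k S) :
    w ∈ IntermediateField.adjoin (algebraMap k K).fieldRange S := by
  rw [← IntermediateField.mem_toSubfield, IntermediateField.adjoin_toSubfield] at hw ⊢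
  refine Subfield.closure_mono ?_ hw
  rw [range_algebraMap_subfield, RingHom.coe_fieldRange]

/-- If `K` is algebraic over `k(S)` then every element of `K` is algebraic over `k̄(S)`, `k̄` the
image of `k` in `K`. [folklore] -/
theorem isAlgebraic_adjoin_fieldRange {S : Set K}
    (halg : Algebra.IsAlgebraic (IntermediateField.adjoin k S) K) (z : K) :
    IsAlgebraic (IntermediateField.adjoin (algebraMap k K).fieldRange S) z := by
  let incl : IntermediateField.adjoin k S →+*
      IntermediateField.adjoin (algebraMap k K).fieldRange S :=
    { toFun := fun w => ⟨w, mem_adjoin_fieldRange_of_mem_adjoin w.2⟩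
      map_one' := rfl
      map_mul' := fun _ _ => rfl
      map_zero' := rfl
      map_add' := fun _ _ => rfl }
  exact isAlgebraic_of_ringHom_comp_eq incl (RingHom.ext fun _ => rfl) (halg.isAlgebraic z)

/-- **A prime divisor is an Abhyankar place** (one-value form of Knaf–Kuhlmann 2005, Thm. 2.1).
Let `O ⊇ k` be a valuation ring of `K` (a `k`-algebra compatibly with `K`), `x₀ ∈ K` with
`v(x₀) < 1`, and `y₁, …, y_τ ∈ O` with
residues algebraically independent over `k`, where `tr.deg_k K ≤ τ + 1`. Then `O` is an
Abhyankar place of `K` over (the image of) `k`, with witnesses `x = (x₀)` and `y`: a power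
`v(x₀)^m`, `m ∈ ℤ`, is the value of a non-zero constant (`= 1`) only for `m = 0`; the residues
of the `y_j` are algebraically independent over the residue field of `k` (onto which `k`
surjects); and distinct monomials in `x₀` have distinct values, so `(x₀, y)` is algebraically
independent over `k` (`algebraicIndependent_sumElim_of_valuation`), hence a transcendence
basis, and `K` is algebraic over `k(x₀, y)`. [cite: KnafKuhlmann2005, Thm. 2.1] -/
theorem isAbhyankarPlace_of_valuation_lt_one {k K : Type} [Field k] [Field K] [Algebra k K]
    (O : ValuationSubring K) [Algebra k O] [IsScalarTower k O K] {x₀ : K}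
    (hv : O.valuation x₀ < 1) (hx₀ : x₀ ≠ 0) {τ : ℕ} (y : Fin τ → O)
    (hy : AlgebraicIndependent k fun j => IsLocalRing.residue O (y j))
    (htr : Algebra.trdeg k K ≤ (τ + 1 : ℕ)) :
    Literature.AlgebraicGeometry.Resolution.IsAbhyankarPlace O (algebraMap k K).fieldRange ⊤ := by
  have hkO : ∀ c : k, algebraMap k K c ∈ O := fun c => by
    rw [IsScalarTower.algebraMap_apply k O K]
    exact (algebraMap k O c).2
  let xv : Fin 1 → K := ![x₀]
  have hxv0 : xv 0 = x₀ := rfl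
  refine ⟨1, τ, xv, fun j => (y j : K), fun j => (y j).2, ?_, fun _ => Subfield.mem_top _,
    ?_, ?_, ?_⟩
  · intro i
    refine ⟨Subfield.mem_top _, ?_⟩
    fin_cases i
    exact hx₀
  · -- the value of `x₀` is `ℤ`-independent modulo `v(k) = 1`
    rintro m ⟨b, hb, hm⟩
    rw [Fin.prod_univ_one, hxv0, ← map_zpow₀ O.valuation] at hm
    have hb0 : b ≠ 0 := by
      rintro rfl
      rw [map_zero, Valuation.zero_iff] at hm
      exact zpow_ne_zero _ hx₀ hm
    have hb1 : O.valuation b = 1 := by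
      obtain ⟨c, rfl⟩ := RingHom.mem_fieldRange.mp hb
      exact (O.valuation_eq_one_iff ⟨_, hkO c⟩).mp
        (isUnit_of_inv_mem O (hkO c) (by rw [← map_inv₀]; exact hkO _) hb0)
    rw [hb1, map_zpow₀] at hm
    exact funext (Fin.forall_fin_one.mpr (eq_zero_of_zpow_eq_one hv hm))
  · -- the residues of the `y_j` are algebraically independent over the residue field of `k`
    obtain ⟨fk, hfk, hfkc⟩ := exists_ringHom_resField_surjective O hkO
    refine hy.ringHom_of_comp_eq fk (RingHom.id (ResidueField O)) hfk
      Function.injective_id (RingHom.ext fun c => ?_)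
    change ((fk c : resField O (algebraMap k K).fieldRange) : ResidueField O) =
      algebraMap k (ResidueField O) c
    rw [hfkc, IsScalarTower.algebraMap_apply k O (ResidueField O), ResidueField.algebraMap_eq]
    congr 1
    exact Subtype.ext (IsScalarTower.algebraMap_apply k O K c)
  · -- `K` is algebraic over `k(x₀, y)`
    have hinj : Function.Injective
        fun μ : Fin 1 →₀ ℕ => O.valuation (μ.prod fun j n => xv j ^ n) := by
      intro μ ν h
      simp only [Finsupp.prod_pow, Fin.prod_univ_one, hxv0] at h
      have key : O.valuation (x₀ ^ ((μ 0 : ℤ) - ν 0)) = 1 := by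
        rw [zpow_sub₀ hx₀, map_div₀]
        simp only [zpow_natCast]
        rw [h]
        exact div_self ((Valuation.ne_zero_iff _).mpr (pow_ne_zero _ hx₀))
      rw [map_zpow₀] at key
      have h0 := eq_zero_of_zpow_eq_one hv key
      exact Finsupp.ext (Fin.forall_fin_one.mpr (by omega))
    have hai : AlgebraicIndependent k (Sum.elim xv fun j => (y j : K)) :=
      algebraicIndependent_sumElim_of_valuation O y hy xv hinj
    have hcard : Cardinal.mk (Fin 1 ⊕ Fin τ) = ((τ + 1 : ℕ) : Cardinal) := by
      simp [add_comm]
    have htb : IsTranscendenceBasis k (Sum.elim xv fun j => (y j : K)) :=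
      hai.isTranscendenceBasis_of_trdeg_le_of_finite (htr.trans_eq hcard.symm)
    intro z _
    rw [← Set.Sum.elim_range]
    exact isAlgebraic_adjoin_fieldRange htb.isAlgebraic_field z

/-- **The trivial place is an Abhyankar place.** For `K | k` of finite transcendence degree `n`,
the valuation ring `K` itself (the trivial valuation) is an Abhyankar place of `K` over (the
image of) `k`: no values (`ρ = 0`), and a transcendence basis `y` of `K | k`, whose "residues"
in `K/0 = K` stay algebraically independent. [cite: KnafKuhlmann2005, Section 1] -/
theorem isAbhyankarPlace_top {n : ℕ} (hn : Algebra.trdeg k K = n) :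
    IsAbhyankarPlace (⊤ : ValuationSubring K) (algebraMap k K).fieldRange ⊤ := by
  classical
  -- a transcendence basis indexed by `Fin n`
  obtain ⟨t, ht⟩ := exists_isTranscendenceBasis k K
  have htn : Cardinal.mk t = n := by rw [ht.cardinalMk_eq_trdeg, hn]
  obtain ⟨eqv⟩ := Cardinal.mk_eq_nat_iff.mp htn
  let y : Fin n → K := ((↑) : t → K) ∘ eqv.symm
  have hty : IsTranscendenceBasis k y := ht.comp_equiv eqv.symm
  refine ⟨0, n, ![], y, fun _ => trivial, fun i => Fin.elim0 i, fun _ => Subfield.mem_top _,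
    fun m _ => funext fun i => Fin.elim0 i, ?_, ?_⟩
  · -- residues: `K → ⊤/𝔪_⊤` is injective
    obtain ⟨fk, hfk, hfkc⟩ := exists_ringHom_resField_surjective (k := k) (⊤ : ValuationSubring K)
      (fun _ => trivial)
    let ι : K →+* (⊤ : ValuationSubring K) := (RingHom.id K).codRestrict _ fun _ => trivial
    let g : K →+* ResidueField (⊤ : ValuationSubring K) := (residue _).comp ι
    have hg : Function.Injective g := g.injective
    exact hty.1.ringHom_of_comp_eq fk g hfk hg (RingHom.ext fun c => hfkc c)
  · intro z _
    have hrange : Set.range (![] : Fin 0 → K) ∪ Set.range y = Set.range y := by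
      rw [Matrix.range_empty, Set.empty_union]
    rw [hrange]
    exact isAlgebraic_adjoin_fieldRange hty.isAlgebraic_field z

/-- **Residue fields along a bijection of local rings.** If `φ : R → O` is a bijective ring map
of local rings (so `𝔪_R = φ⁻¹ 𝔪_O`), the induced map `κ(R) → κ(O)` is bijective, hence `κ(O)`
is formally smooth over `κ(R)`. [folklore] -/
theorem formallySmooth_quotient_of_bijective {R O : Type} [CommRing R] [IsLocalRing R]
    [CommRing O] [IsLocalRing O] (φ : R →+* O) (hφ : Function.Bijective φ)
    (hdom : maximalIdeal R ≤ (maximalIdeal O).comap φ) :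
    @Algebra.FormallySmooth (R ⧸ maximalIdeal R) (O ⧸ maximalIdeal O) _ _
      (Ideal.quotientMap (maximalIdeal O) φ hdom).toAlgebra := by
  letI := (Ideal.quotientMap (maximalIdeal O) φ hdom).toAlgebra
  let e : R ≃+* O := RingEquiv.ofBijective φ hφ
  have hbij : Function.Bijective (algebraMap (R ⧸ maximalIdeal R) (O ⧸ maximalIdeal O)) := by
    constructor
    · rw [injective_iff_map_eq_zero]
      intro x hx
      obtain ⟨r, rfl⟩ := Ideal.Quotient.mk_surjective x
      change Ideal.Quotient.mk (maximalIdeal O) (φ r) = 0 at hx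
      rw [Ideal.Quotient.eq_zero_iff_mem, mem_maximalIdeal, mem_nonunits_iff] at hx ⊢
      exact fun hr => hx (hr.map φ)
    · intro x
      obtain ⟨o, rfl⟩ := Ideal.Quotient.mk_surjective x
      obtain ⟨r, rfl⟩ := hφ.2 o
      exact ⟨Ideal.Quotient.mk _ r, rfl⟩
  haveI : Algebra.FormallySmooth (R ⧸ maximalIdeal R) (R ⧸ maximalIdeal R) := inferInstance
  exact Algebra.FormallySmooth.of_equiv
    (AlgEquiv.ofBijective (Algebra.ofId (R ⧸ maximalIdeal R) (O ⧸ maximalIdeal O)) hbij)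

end Summit.ResolutionOfSingularities.ResolutionOfSingularities.Theorems.SepExcModels.ModelValuationAbhyankar

end
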